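import Summits.CriticalPhenomena.PercolationContinuityZ3.Theorems.FK.RandomClusterEdgeDensityLargeDeviations
import Summits.CriticalPhenomena.PercolationContinuityZ3.Theorems.FK.ClusterCountBoundaryCorrection
import HarnessLib

/-!
# LARGE DEVIATIONS OF THE NUMBER OF OPEN EDGES OF THE RANDOM-CLUSTER MODEL, IV: THE COST OF A BOUNDARY CONDITION ON EVENTS IS AT MOST
# `q^{|∂Λ_N|}`, AND THE ENDPOINT EVENTS `{|ω| ≥ (d·h¹ − δ)|Λ_N|}` / `{|ω| ≤ (d·h⁰ + δ)|Λ_N|}` ARE MASSIVE UNDER THEIR OWN BOUNDARY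
# CONDITION (Grimmett 2006 Thm. (4.58) with (4.71), (4.72)–(4.78))

Claimed R42 (8)(c) in the cell INBOX at 2026-08-29T13:10:41Z by fkp-10a gen 360 (NEW CLAIM #5 of the gen), addressed to coordinator fk-4 gen 299 (seated 12:03Z 2026-08-29; R182–R185 in force; ruling R186 requested); lineage row FO-10a-g360x (self-suggested), package g360-rccoex, label RC-D.
Helper file of the `fk-continuity` build cell (bschramm lane; `--supports stmt-CriticalPhenomena-4575`; fkp-10a gen 360,
package g360-rccoex, label RC-D); builds on p205010 (kernel theorem, internal audit signed; external expert review
pending). No definitions, no named facts, no sorries; standard axioms.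
UNCONDITIONAL (`φ^B_{G,p,q}` on ANY finite graph with any finite wired set `B`, `q ≥ 1`, `0 ≤ p ≤ 1`, for the comparison and Markov
lemmas; random-cluster box measures `φ^b_{Λ_N,p,q} = rcMeasure (finsetGraph (zdGraph d) (box d N)) p q (boxBC d b N)`, `b ∈ {free, wired}`,
`q ≥ 1`, a lattice edge `e₀` (so `d ≥ 1`); `|ω|` = number of open edges, `h⁰ = freeEdgeDensity`, `h¹ = wiredEdgeDensity`,
`∂Λ_N = innerBoundary`).
Scope: finite-volume comparison / Markov inequalities and one analysis lemma; nothing at or about `p_c(q)`, nothing on FH / TP_FK;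
nothing percolation-bearing.

* `pow_inv_mul_rcExpect_free_le_wired`, `pow_inv_mul_rcExpect_wired_le_free` — `q^{−(|B|−1)} E^∅ g ≤ E^B g`, `q^{−(|B|−1)} E^B g ≤ E^∅ g`
  for `g ≥ 0` (`w^B ≤ w^∅ ≤ q^{|B|−1} w^B`, Grimmett's (4.71));
* **`pow_inv_mul_rcMeasure_box_real_le`** — on `Λ_N` ANY two of the box boundary conditions differ by at most the factor `q^{|∂Λ_N|}` on
  EVERY event: `q^{−|∂Λ_N|} φ^b_{Λ_N}(S) ≤ φ^{b'}_{Λ_N}(S)`;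
* `rcExpect_indicator_ge_of_le`, `rcExpect_indicator_le_of_nonneg` — Markov's inequality for `0 ≤ |ω| ≤ |E|`;
* **`exists_pos_eventually_le_wired_high`**, **`exists_pos_eventually_le_free_low`** — `φ¹_{Λ_N}{(d·h¹ − δ)|Λ_N| ≤ |ω|} ≥ κ > 0` and
  `φ⁰_{Λ_N}{|ω| ≤ (d·h⁰ + δ)|Λ_N|} ≥ κ > 0` for all large `N` (mean edge densities `→ d·h¹`, `d·h⁰`: tree `PressureEdgeDensity`);
* `eventually_forall_exp_le_of_boundary_sub_exp` — `q^{−|∂Λ_N|} κ − e^{−c|Λ_N|} ≥ e^{−ε|Λ_N|}` eventually (`|∂Λ_N|/|Λ_N| → 0`).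

The sequel `RandomClusterEdgeDensityCoexistence` draws the consequence: both endpoint densities `d·h⁰`, `d·h¹` are reached at
sub-volume-order cost under both boundary conditions and under every infinite-volume random-cluster measure.

## References

* G. Grimmett, *The Random-Cluster Model*, Springer (2006), §4.5 Thm. (4.58) with (4.71) (`Y⁰_Λ e^{−κ|∂Λ|} ≤ Y^ξ_Λ ≤ Y⁰_Λ`),
  (4.72)–(4.78). [Grimmett2006]
* R. S. Ellis, *Entropy, Large Deviations, and Statistical Mechanics*, Springer (2006), Thm. II.6.1. [Ellis2006]
-/

noncomputable section

namespace Summit.CriticalPhenomena.PercolationContinuityZ3.Theorems.FK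

namespace RandomClusterLargeDeviations

open Finset Filter Topology Set MeasureTheory
open Literature.Probability.LatticeModels Literature.Probability.Percolation

/-! ### The cost of a boundary condition on expectations: at most `q^{|B|−1}` -/

section Finite

variable {V : Type*} [Fintype V] [DecidableEq V] (G : SimpleGraph V) [DecidableRel G.Adj]

/-- **`q^{−(|B|−1)} E^∅_{G,p,q} g ≤ E^B_{G,p,q} g`** for `g ≥ 0`, `q ≥ 1` (`w^B ≥ q^{−(|B|−1)} w^∅`, `Z^B ≤ Z^∅`).
[cite: Grimmett2006, proof of Thm. (4.58), (4.71)] -/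
theorem pow_inv_mul_rcExpect_free_le_wired {p q : ℝ} (hp : p ∈ Set.Icc (0 : ℝ) 1) (hq : 1 ≤ q) (B : Finset V)
    {g : Finset (Sym2 V) → ℝ} (hg : ∀ ω ⊆ G.edgeFinset, 0 ≤ g ω) :
    (q ^ (#B - 1))⁻¹ * rcExpect G p q ∅ g ≤ rcExpect G p q (↑B : Set V) g := by
  have hq0 : 0 < q := one_pos.trans_le hq
  have hqpow : 0 < q ^ (#B - 1) := pow_pos hq0 _
  have hZ0 := rcPartitionFunction_pos G hp hq0 (∅ : Set V)
  have hZB := rcPartitionFunction_pos G hp hq0 (↑B : Set V)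
  rw [rcExpect, rcExpect, Finset.mul_sum]
  refine Finset.sum_le_sum fun ω hω => ?_
  have hω' := Finset.mem_powerset.1 hω
  have hw : rcWeight G p q ∅ ω ≤ q ^ (#B - 1) * rcWeight G p q (↑B : Set V) ω := rcWeight_free_le_pow_mul_wired G hp hq B ω
  have hZle : rcPartitionFunction G p q (↑B : Set V) ≤ rcPartitionFunction G p q ∅ := rcPartitionFunction_wired_le_free G hp hq _
  have hg' := hg ω hω'
  calc (q ^ (#B - 1))⁻¹ * (rcWeight G p q ∅ ω / rcPartitionFunction G p q ∅ * g ω)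
      = (rcWeight G p q ∅ ω / q ^ (#B - 1)) / rcPartitionFunction G p q ∅ * g ω := by
        field_simp
    _ ≤ rcWeight G p q (↑B : Set V) ω / rcPartitionFunction G p q (↑B : Set V) * g ω := by
        refine mul_le_mul_of_nonneg_right ?_ hg'
        exact div_le_div₀ (rcWeight_nonneg G hp hq0.le _ ω) ((div_le_iff₀ hqpow).2 (by rw [mul_comm]; exact hw)) hZB hZle

/-- **`q^{−(|B|−1)} E^B_{G,p,q} g ≤ E^∅_{G,p,q} g`** for `g ≥ 0`, `q ≥ 1` (`w^∅ ≥ w^B`, `Z^∅ ≤ q^{|B|−1} Z^B`).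
[cite: Grimmett2006, proof of Thm. (4.58), (4.71)] -/
theorem pow_inv_mul_rcExpect_wired_le_free {p q : ℝ} (hp : p ∈ Set.Icc (0 : ℝ) 1) (hq : 1 ≤ q) (B : Finset V)
    {g : Finset (Sym2 V) → ℝ} (hg : ∀ ω ⊆ G.edgeFinset, 0 ≤ g ω) :
    (q ^ (#B - 1))⁻¹ * rcExpect G p q (↑B : Set V) g ≤ rcExpect G p q ∅ g := by
  have hq0 : 0 < q := one_pos.trans_le hq
  have hqpow : 0 < q ^ (#B - 1) := pow_pos hq0 _
  have hZ0 := rcPartitionFunction_pos G hp hq0 (∅ : Set V)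
  have hZB := rcPartitionFunction_pos G hp hq0 (↑B : Set V)
  rw [rcExpect, rcExpect, Finset.mul_sum]
  refine Finset.sum_le_sum fun ω hω => ?_
  have hω' := Finset.mem_powerset.1 hω
  have hw : rcWeight G p q (↑B : Set V) ω ≤ rcWeight G p q ∅ ω := rcWeight_wired_le_free G hp hq _ ω
  have hZle : rcPartitionFunction G p q ∅ ≤ q ^ (#B - 1) * rcPartitionFunction G p q (↑B : Set V) :=
    rcPartitionFunction_free_le_pow_mul_wired G hp hq B
  have hg' := hg ω hω'
  calc (q ^ (#B - 1))⁻¹ * (rcWeight G p q (↑B : Set V) ω / rcPartitionFunction G p q (↑B : Set V) * g ω)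
      = rcWeight G p q (↑B : Set V) ω / (q ^ (#B - 1) * rcPartitionFunction G p q (↑B : Set V)) * g ω := by
        field_simp
    _ ≤ rcWeight G p q ∅ ω / rcPartitionFunction G p q ∅ * g ω := by
        refine mul_le_mul_of_nonneg_right ?_ hg'
        exact div_le_div₀ (rcWeight_nonneg G hp hq0.le _ ω) hw hZ0 hZle

/-- **Markov, upper event**: if `g ω = |ω|` has mean `≥ μ` and `|ω| ≤ M` (`M > 0`), then `E 1{a ≤ |ω|} ≥ (μ − max a 0)/M`.
[folklore] -/
theorem rcExpect_indicator_ge_of_le {p q : ℝ} (hp : p ∈ Set.Icc (0 : ℝ) 1) (hq : 0 < q) (B : Set V) {M μ : ℝ} (hM : 0 < M)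
    (hbound : (#G.edgeFinset : ℝ) ≤ M) (hmean : μ ≤ rcExpect G p q B (fun ω => (#ω : ℝ))) (a : ℝ) :
    (μ - max a 0) / M ≤ rcExpect G p q B (fun ω => if a ≤ (#ω : ℝ) then 1 else 0) := by
  rw [div_le_iff₀ hM]
  -- pointwise: `|ω| ≤ max a 0 + M · 1{a ≤ |ω|}`
  have hpt : ∀ ω ⊆ G.edgeFinset, (#ω : ℝ) ≤ max a 0 + M * (if a ≤ (#ω : ℝ) then 1 else 0) := by
    intro ω hω
    have hcard : (#ω : ℝ) ≤ M := le_trans (by exact_mod_cast Finset.card_le_card hω) hbound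
    split_ifs with h
    · linarith [le_max_right a 0]
    · push Not at h
      linarith [le_max_left a 0]
  have h1 := rcExpect_mono G hp hq B hpt
  rw [rcExpect_add, rcExpect_const G hp hq, rcExpect_const_mul] at h1
  linarith

/-- **Markov, lower event**: if `|ω| ≥ 0` has mean `≤ μ` and `b > 0`, then `E 1{|ω| ≤ b} ≥ (b − μ)/b`. [folklore] -/
theorem rcExpect_indicator_le_of_nonneg {p q : ℝ} (hp : p ∈ Set.Icc (0 : ℝ) 1) (hq : 0 < q) (B : Set V) {b μ : ℝ} (hb : 0 < b)
    (hmean : rcExpect G p q B (fun ω => (#ω : ℝ)) ≤ μ) :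
    (b - μ) / b ≤ rcExpect G p q B (fun ω => if (#ω : ℝ) ≤ b then 1 else 0) := by
  rw [div_le_iff₀ hb]
  have hpt : ∀ ω ⊆ G.edgeFinset, b - b * (if (#ω : ℝ) ≤ b then 1 else 0) ≤ (#ω : ℝ) := by
    intro ω _
    split_ifs with h
    · simp
    · push Not at h
      linarith
  have h1 := rcExpect_mono G hp hq B hpt
  rw [rcExpect_sub, rcExpect_const G hp hq, rcExpect_const_mul] at h1
  linarith

end Finite

/-! ### The boxes: the boundary condition costs at most `q^{|∂Λ_N|}` on every event -/

variable {d : ℕ} {p q : ℝ} {e₀ : Sym2 (Site d)}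

/-- **ANY TWO BOX BOUNDARY CONDITIONS DIFFER BY AT MOST THE FACTOR `q^{|∂Λ_N|}` ON EVERY EVENT**:
`q^{−|∂Λ_N|} φ^{b}_{Λ_N,p,q}(S) ≤ φ^{b'}_{Λ_N,p,q}(S)` for all `b, b'` (`q ≥ 1`). [cite: Grimmett2006, proof of Thm. (4.58), (4.71)] -/
theorem pow_inv_mul_rcMeasure_box_real_le (hp : p ∈ Set.Icc (0 : ℝ) 1) (hq : 1 ≤ q) (N : ℕ) (b b' : Bool)
    (S : Set (BondConfig ↥(box d N))) :
    (q ^ #(innerBoundary (zdGraph d) (box d N)))⁻¹ * (rcMeasure (finsetGraph (zdGraph d) (box d N)) p q (boxBC d b N)).real S ≤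
      (rcMeasure (finsetGraph (zdGraph d) (box d N)) p q (boxBC d b' N)).real S := by
  classical
  have hq0 : 0 < q := one_pos.trans_le hq
  set G := finsetGraph (zdGraph d) (box d N)
  set B : Finset ↥(box d N) := Finset.univ.filter fun x => x.1 ∈ innerBoundary (zdGraph d) (box d N) with hB
  have hBc : (↑B : Set ↥(box d N)) = boxBC d true N := by
    ext x
    rw [Finset.mem_coe, hB, Finset.mem_filter, show boxBC d true N = wiredBoundary (zdGraph d) (box d N) from rfl,
      mem_wiredBoundary_iff]
    simp
  have hcardB : #B ≤ #(innerBoundary (zdGraph d) (box d N)) := by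
    refine Finset.card_le_card_of_injOn (fun x => x.1) (fun x hx => ?_) (fun x _ y _ h => Subtype.ext h)
    rw [Finset.mem_coe, hB, Finset.mem_filter] at hx
    exact hx.2
  have h0 : boxBC d false N = (∅ : Set ↥(box d N)) := rfl
  -- `q^{−|∂Λ|} ≤ q^{−(|B|−1)}`
  have hpow : (q ^ #(innerBoundary (zdGraph d) (box d N)))⁻¹ ≤ (q ^ (#B - 1))⁻¹ := by
    refine inv_anti₀ (pow_pos hq0 _) (pow_le_pow_right₀ hq ?_)
    omega
  have hSnn : 0 ≤ (rcMeasure G p q (boxBC d b N)).real S := measureReal_nonneg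
  rw [rcMeasure_real_eq_rcExpect G hp hq0, rcMeasure_real_eq_rcExpect G hp hq0] at *
  have hg : ∀ ω ⊆ G.edgeFinset, (0 : ℝ) ≤ (if (↑ω : BondConfig ↥(box d N)) ∈ S then 1 else 0) := fun ω _ => by
    split_ifs <;> norm_num
  cases b <;> cases b'
  · -- free vs free
    calc (q ^ #(innerBoundary (zdGraph d) (box d N)))⁻¹ * rcExpect G p q (boxBC d false N) _
        ≤ 1 * rcExpect G p q (boxBC d false N) _ :=
          mul_le_mul_of_nonneg_right (inv_le_one_of_one_le₀ (one_le_pow₀ hq)) hSnn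
      _ = _ := one_mul _
  · -- free vs wired
    calc (q ^ #(innerBoundary (zdGraph d) (box d N)))⁻¹ * rcExpect G p q (boxBC d false N) _
        ≤ (q ^ (#B - 1))⁻¹ * rcExpect G p q (boxBC d false N) _ := mul_le_mul_of_nonneg_right hpow hSnn
      _ ≤ rcExpect G p q (boxBC d true N) _ := by
          rw [h0, ← hBc]; exact pow_inv_mul_rcExpect_free_le_wired G hp hq B hg
  · -- wired vs free
    calc (q ^ #(innerBoundary (zdGraph d) (box d N)))⁻¹ * rcExpect G p q (boxBC d true N) _
        ≤ (q ^ (#B - 1))⁻¹ * rcExpect G p q (boxBC d true N) _ := mul_le_mul_of_nonneg_right hpow hSnn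
      _ ≤ rcExpect G p q (boxBC d false N) _ := by
          rw [h0, ← hBc]; exact pow_inv_mul_rcExpect_wired_le_free G hp hq B hg
  · -- wired vs wired
    calc (q ^ #(innerBoundary (zdGraph d) (box d N)))⁻¹ * rcExpect G p q (boxBC d true N) _
        ≤ 1 * rcExpect G p q (boxBC d true N) _ :=
          mul_le_mul_of_nonneg_right (inv_le_one_of_one_le₀ (one_le_pow₀ hq)) hSnn
      _ = _ := one_mul _

/-! ### The endpoint events have probability bounded below under their own boundary condition -/

/-- **`φ¹_{Λ_N,p,q}{(d·h¹ − δ)|Λ_N| ≤ |ω|} ≥ κ > 0` for all large `N`** (`q ≥ 1`, `δ > 0`): the mean wired edge density tends to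
`d·h¹(p,q)` and `|ω| ≤ |E_{Λ_N}| ≤ (d+1)|Λ_N|`; Markov. [cite: Grimmett2006, Thm. (4.58), (4.72)–(4.78)] -/
theorem exists_pos_eventually_le_wired_high (hp : p ∈ Set.Icc (0 : ℝ) 1) (hq : 1 ≤ q) (he₀ : e₀ ∈ (zdGraph d).edgeSet)
    {δ : ℝ} (hδ : 0 < δ) :
    ∃ κ : ℝ, 0 < κ ∧ ∀ᶠ N : ℕ in atTop,
      κ ≤ (rcMeasure (finsetGraph (zdGraph d) (box d N)) p q (boxBC d true N)).real
        {η : BondConfig ↥(box d N) | (d * wiredEdgeDensity d p q e₀ - δ) * #(box d N) ≤ (η.ncard : ℝ)} := by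
  have hq0 : 0 < q := one_pos.trans_le hq
  refine ⟨min 1 (δ / 2 / (d + 1)), by positivity, ?_⟩
  have hmean := tendsto_rcExpect_card_div_card_box_true (d := d) hp hq he₀
  have hE := tendsto_card_edgeFinset_box_div_card_box (d := d)
  filter_upwards [hmean.eventually (lt_mem_nhds (show d * wiredEdgeDensity d p q e₀ - δ / 2 < _ by linarith)),
    hE.eventually (gt_mem_nhds (show (d : ℝ) < d + 1 by linarith))] with N hN hEN
  haveI := isProbabilityMeasure_rcMeasure (finsetGraph (zdGraph d) (box d N)) hp hq0 (boxBC d true N)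
  have hV : (0 : ℝ) < #(box d N) := by exact_mod_cast (box_nonempty d N).card_pos
  rw [lt_div_iff₀ hV] at hN
  rw [div_lt_iff₀ hV] at hEN
  by_cases ha : (d * wiredEdgeDensity d p q e₀ - δ) * #(box d N) ≤ 0
  · have huniv : {η : BondConfig ↥(box d N) | (d * wiredEdgeDensity d p q e₀ - δ) * #(box d N) ≤ (η.ncard : ℝ)} = Set.univ :=
      Set.eq_univ_of_forall fun η => ha.trans (Nat.cast_nonneg _)
    rw [huniv, probReal_univ]
    exact min_le_left _ _
  · push Not at ha
    rw [rcMeasure_real_ncard_ge_eq _ hp hq0]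
    have h := rcExpect_indicator_ge_of_le (finsetGraph (zdGraph d) (box d N)) hp hq0 (boxBC d true N)
      (M := (d + 1) * #(box d N)) (by positivity) hEN.le hN.le ((d * wiredEdgeDensity d p q e₀ - δ) * #(box d N))
    rw [max_eq_left ha.le] at h
    refine (min_le_right _ _).trans (le_trans (le_of_eq ?_) h)
    field_simp
    ring

/-- **`φ⁰_{Λ_N,p,q}{|ω| ≤ (d·h⁰ + δ)|Λ_N|} ≥ κ > 0` for all large `N`** (`q ≥ 1`, `δ > 0`): the mean free edge density tends to
`d·h⁰(p,q)`, `|ω| ≥ 0`; Markov. [cite: Grimmett2006, Thm. (4.58), (4.72)–(4.78)] -/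
theorem exists_pos_eventually_le_free_low (hp : p ∈ Set.Icc (0 : ℝ) 1) (hq : 1 ≤ q) (he₀ : e₀ ∈ (zdGraph d).edgeSet)
    {δ : ℝ} (hδ : 0 < δ) :
    ∃ κ : ℝ, 0 < κ ∧ ∀ᶠ N : ℕ in atTop,
      κ ≤ (rcMeasure (finsetGraph (zdGraph d) (box d N)) p q (boxBC d false N)).real
        {η : BondConfig ↥(box d N) | (η.ncard : ℝ) ≤ (d * freeEdgeDensity d p q e₀ + δ) * #(box d N)} := by
  have hq0 : 0 < q := one_pos.trans_le hq
  have hh0 : 0 ≤ freeEdgeDensity d p q e₀ := by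
    obtain ⟨i, x, rfl⟩ := exists_eq_map_add_of_mem_edgeSet he₀
    exact (freeEdgeProb_nonneg _ _ _ _).trans (boxFreeEdgeProb_le_freeEdgeDensity hp hq0 (N := pairRad _) le_rfl)
  have hpos : 0 < d * freeEdgeDensity d p q e₀ + δ := by positivity
  refine ⟨δ / 2 / (d * freeEdgeDensity d p q e₀ + δ), by positivity, ?_⟩
  have hmean := tendsto_rcExpect_card_div_card_box_false (d := d) hp hq he₀
  filter_upwards [hmean.eventually (gt_mem_nhds (show _ < d * freeEdgeDensity d p q e₀ + δ / 2 by linarith))] with N hN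
  have hV : (0 : ℝ) < #(box d N) := by exact_mod_cast (box_nonempty d N).card_pos
  rw [div_lt_iff₀ hV] at hN
  rw [rcMeasure_real_ncard_le_eq _ hp hq0]
  have h := rcExpect_indicator_le_of_nonneg (finsetGraph (zdGraph d) (box d N)) hp hq0 (boxBC d false N)
    (b := (d * freeEdgeDensity d p q e₀ + δ) * #(box d N)) (by positivity) hN.le
  have hrhs : ((d * freeEdgeDensity d p q e₀ + δ) * #(box d N) - (d * freeEdgeDensity d p q e₀ + δ / 2) * #(box d N)) /
      ((d * freeEdgeDensity d p q e₀ + δ) * #(box d N)) = δ / 2 / (d * freeEdgeDensity d p q e₀ + δ) := by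
    field_simp
    ring
  rw [hrhs] at h
  exact h

/-! ### Analysis: a boundary-order factor minus an exponentially small term is eventually at least `e^{−ε|Λ_N|}` -/

/-- If eventually, for all `i`, `q^{−|∂Λ_N|} κ − e^{−c|Λ_N|} ≤ f_N(i)` (`κ, c > 0`, `q ≥ 1`), then for every `ε > 0` eventually, for all
`i`, `e^{−ε|Λ_N|} ≤ f_N(i)` (`|∂Λ_N|/|Λ_N| → 0`). [cite: Grimmett2006, proof of Thm. (4.58), (4.71)] -/
theorem eventually_forall_exp_le_of_boundary_sub_exp (hq : 1 ≤ q) {κ c : ℝ} (hκ : 0 < κ) (hc : 0 < c) {ι : Type*}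
    {f : ℕ → ι → ℝ} (hf : ∀ᶠ N : ℕ in atTop, ∀ i,
      (q ^ #(innerBoundary (zdGraph d) (box d N)))⁻¹ * κ - Real.exp (-(c * #(box d N))) ≤ f N i)
    (hd : 0 < d) {ε : ℝ} (hε : 0 < ε) :
    ∀ᶠ N : ℕ in atTop, ∀ i, Real.exp (-(ε * #(box d N))) ≤ f N i := by
  set ε' : ℝ := min ε c / 2 with hε'
  have hmin : 0 < min ε c := lt_min hε hc
  have hε'pos : 0 < ε' := by positivity
  have h2c : 2 * ε' ≤ c := by rw [hε']; linarith [min_le_right ε c]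
  have h2ε : 2 * ε' ≤ ε := by rw [hε']; linarith [min_le_left ε c]
  have hcard : Tendsto (fun N : ℕ => (#(box d N) : ℝ)) atTop atTop := by
    refine tendsto_atTop_mono (fun N => ?_) tendsto_natCast_atTop_atTop
    have h1 : N ≤ #(box d N) := by
      rw [card_box]
      exact (show N ≤ 2 * N + 1 by omega).trans (Nat.le_self_pow (by omega) _)
    exact_mod_cast h1
  -- `q^{−|∂Λ_N|} κ ≥ e^{−ε' |Λ_N|}` eventually: `|∂Λ_N| log q ≤ (ε'/2)|Λ_N|` and `κ ≥ e^{−(ε'/2)|Λ_N|}`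
  have hev1 : ∀ᶠ N : ℕ in atTop, Real.exp (-(ε' * #(box d N))) ≤ (q ^ #(innerBoundary (zdGraph d) (box d N)))⁻¹ * κ := by
    have hr := tendsto_card_innerBoundary_box_div_card_box (d := d)
    have hA : ∀ᶠ N : ℕ in atTop, (#(innerBoundary (zdGraph d) (box d N)) : ℝ) / #(box d N) < ε' / 2 / (Real.log q + 1) :=
      hr.eventually (gt_mem_nhds (by have := Real.log_nonneg hq; positivity))
    have hB : ∀ᶠ N : ℕ in atTop, Real.exp (-(ε' / 2 * (#(box d N) : ℝ))) ≤ κ := by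
      have h1 : Tendsto (fun N : ℕ => Real.exp (-(ε' / 2 * (#(box d N) : ℝ)))) atTop (𝓝 0) :=
        Real.tendsto_exp_atBot.comp (tendsto_neg_atTop_atBot.comp (hcard.const_mul_atTop (by positivity)))
      exact h1.eventually (eventually_le_nhds hκ)
    filter_upwards [hA, hB] with N hA hB
    have hV : (0 : ℝ) < #(box d N) := by exact_mod_cast (box_nonempty d N).card_pos
    have hlogq : 0 ≤ Real.log q := Real.log_nonneg hq
    rw [div_lt_iff₀ hV] at hA
    have hA' : (#(innerBoundary (zdGraph d) (box d N)) : ℝ) * Real.log q ≤ ε' / 2 * #(box d N) := by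
      have hL : (0 : ℝ) < Real.log q + 1 := by positivity
      have h1 : (#(innerBoundary (zdGraph d) (box d N)) : ℝ) * (Real.log q + 1) ≤ ε' / 2 * #(box d N) := by
        calc (#(innerBoundary (zdGraph d) (box d N)) : ℝ) * (Real.log q + 1)
            ≤ ε' / 2 / (Real.log q + 1) * #(box d N) * (Real.log q + 1) := mul_le_mul_of_nonneg_right hA.le hL.le
          _ = ε' / 2 * #(box d N) := by field_simp
      nlinarith [(Nat.cast_nonneg _ : (0 : ℝ) ≤ (#(innerBoundary (zdGraph d) (box d N)) : ℝ))]
    have hq0 : 0 < q := one_pos.trans_le hq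
    rw [← Real.rpow_natCast, ← Real.exp_log (Real.rpow_pos_of_pos hq0 _), Real.log_rpow hq0, ← Real.exp_neg]
    calc Real.exp (-(ε' * #(box d N))) = Real.exp (-(ε' / 2 * #(box d N))) * Real.exp (-(ε' / 2 * #(box d N))) := by
          rw [← Real.exp_add]; congr 1; ring
      _ ≤ Real.exp (-((#(innerBoundary (zdGraph d) (box d N)) : ℝ) * Real.log q)) * κ :=
          mul_le_mul (Real.exp_le_exp.2 (by linarith)) hB (Real.exp_pos _).le (Real.exp_pos _).le
  have hev2 : ∀ᶠ N : ℕ in atTop, Real.exp (-(ε' * (#(box d N) : ℝ))) ≤ 1 / 2 := by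
    have h1 : Tendsto (fun N : ℕ => Real.exp (-(ε' * (#(box d N) : ℝ)))) atTop (𝓝 0) :=
      Real.tendsto_exp_atBot.comp (tendsto_neg_atTop_atBot.comp (hcard.const_mul_atTop hε'pos))
    exact h1.eventually (eventually_le_nhds (by norm_num))
  filter_upwards [hf, hev1, hev2] with N hN h1 h2 i
  set u : ℝ := Real.exp (-(ε' * (#(box d N) : ℝ))) with hu
  have hu0 : 0 < u := Real.exp_pos _
  have h3 : Real.exp (-(c * (#(box d N) : ℝ))) ≤ u * u := by
    rw [hu, ← Real.exp_add, Real.exp_le_exp]; nlinarith [(Nat.cast_nonneg _ : (0 : ℝ) ≤ (#(box d N) : ℝ))]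
  have h4 : Real.exp (-(ε * (#(box d N) : ℝ))) ≤ u * u := by
    rw [hu, ← Real.exp_add, Real.exp_le_exp]; nlinarith [(Nat.cast_nonneg _ : (0 : ℝ) ≤ (#(box d N) : ℝ))]
  calc Real.exp (-(ε * (#(box d N) : ℝ))) ≤ u * u := h4
    _ ≤ u * (1 / 2) := mul_le_mul_of_nonneg_left h2 hu0.le
    _ = u - u * (1 / 2) := by ring
    _ ≤ u - u * u := by gcongr
    _ ≤ (q ^ #(innerBoundary (zdGraph d) (box d N)))⁻¹ * κ - Real.exp (-(c * #(box d N))) := sub_le_sub h1 h3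
    _ ≤ f N i := hN i

end RandomClusterLargeDeviations

end Summit.CriticalPhenomena.PercolationContinuityZ3.Theorems.FK
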